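import Literature.Analysis.FluidPDE.KNSSTypeIRateMild
import Literature.Analysis.FluidPDE.KNSSTypeIRateVertexProofs
import HarnessLib

/-!
# KNSS 2009, proof of Theorem 6.2: the vertex estimate over mild data (discharged)

Analysis/FluidPDE proofs file (everything proved; no definitions, no named facts) for the named
fact `Literature.Analysis.FluidPDE.KNSS2009_typeI_rate_mildVertex` (`KNSSTypeIRateMild.lean`;
Koch–Nadirashvili–Seregin–Šverák, *Liouville theorems for the Navier–Stokes equations and
applications*, Acta Math. 203 (2009) 83–105 = arXiv:0709.3599, proof of Theorem 6.2, last
paragraph, arXiv p. 13):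

> "… `w⁽ᵏ⁾(0,0) → w(0,0)`, which is not immediately obvious since our bound of
> `sup_x|w⁽ᵏ⁾(x,τ)|` may not be uniform as `τ → 0`. However, by (wkbound) the only possible
> problem may occur due to the contribution from the cylinder `𝒞_k`. In the cylinder we can use
> the bound (wkbound2) to show that the contribution of the dangerous part of `w⁽ᵏ⁾` to the
> representation formula (3.3) is negligible (in the limit `k → ∞`). Applying the representation
> formula (3.3) in `ℝ³ × (-1, 0)` with `w⁽ᵏ⁾(x, -1)` as initial datum and
> `f_{jl} = -w⁽ᵏ⁾_l w⁽ᵏ⁾_j` and using the bound (wkbound2) together with the decay of the kernel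
> (3.8), one sees that it is enough to estimate the integral `I(M)` … An easy calculation shows
> that `I(M) → 0` as `M → ∞`."

The fact is now a theorem, `KNSS2009_typeI_rate_mildVertex_holds`. Its proof is the proof of
`KNSS2009_typeI_rate_vertex_of_mild` (`KNSSTypeIRateVertexProofs.lean`, which derives the
vertex estimate `KNSS2009_typeI_rate_vertex` of `KNSSTypeIRateCore` from the mildness fact
`KNSS2009_mild_of_rMulNorm_bounded`) verbatim, except that the representation formula (3.3) at
the vertex on `(-1, 0]` — the only place where that proof invokes the mildness fact — is now read
off the Oseen hypothesis that `KNSS2009_typeI_rate_mildVertex` carries explicitly (the `w⁽ᵏ⁾`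
satisfy `w⁽ᵏ⁾(t) = e^{(t−s)Δ}w⁽ᵏ⁾(s) − B¹_s(w⁽ᵏ⁾, w⁽ᵏ⁾)(t)` for all `A_k < s < t < B_k`; take
`s = -1` once `A_k < -1`). The analytic ingredients are those of the sibling file:

1. the datum `w⁽ᵏ⁾(-1)` is bounded by `C` ((wkbound3)), so the caloric part moves by at most
   `K_h(C) √(-τ)` between the times `1 + τ ≥ 1/2` and `1`
   (`norm_heatExtension_sub_heatExtension_le_of_bound`, `KNSSRegularityGalileanProofs`);
2. the Duhamel term splits along `ℝ³ = 𝒞_k ⊔ 𝒞_kᶜ` (`oseenDuhamel_eq_add_of_indicator_compl`);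
3. off the cylinder `|w⁽ᵏ⁾| ≤ K` ((wkbound)), and the Duhamel term of fields bounded by `K` has
   a modulus of continuity in time at a point depending only on `K`
   (`exists_forall_norm_oseenDuhamel_sub_le`, `OseenDuhamelPointwiseContinuity` — the
   qualitative `L^∞` form of (3.10));
4. on the cylinder, (3.8) at the vertex and (wkbound2) bound the Duhamel term by `C₂K²/M_k`
   uniformly in `t ∈ (-1, 0]` (`exists_norm_oseenDuhamel_cylinder_vertex_le`, i.e. the printed
   `I(M) → 0`, with rate `1/M`, `KNSSTypeIRateVertexCylinder`);

so for `τ ∈ [-δ, 0]`, `δ = min(δ_heat, δ_Duhamel)`, and `k` large (`A_k < -1`,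
`C₂K²/M_k ≤ ε/6`), `‖w⁽ᵏ⁾(0,0) - w⁽ᵏ⁾(τ,0)‖ ≤ ε/3 + ε/3 + ε/6 + ε/6 = ε`.

With this theorem the vertex hypothesis of the glue of `KNSSTypeIRateMildProofs`
(`KNSS2009_typeI_rate_mildBlowupSequence_of_mildCore`,
`KNSS2009_typeI_rate_rMulNorm_bounded_of_mildCore`, `KNSS2009_regularity_typeI_rate_of_mildCore`)
is fed by `KNSS2009_typeI_rate_mildVertex_holds`, so that Steps 5–6 over mild data, the main step
of Theorem 6.2 and Theorem 6.2 as vendored rest on the mildness clause `KNSS2009_typeI_rate_mild`,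
compactness over mild data `KNSS2009_typeI_rate_mildCompactness` and the Liouville step
`KNSS2009_typeI_rate_liouville` (plus Theorem 6.1 for the last); this file deliberately imports
only the facts file and the vertex proofs file.

## References

* G. Koch, N. Nadirashvili, G. Seregin, V. Šverák, *Liouville theorems for the Navier–Stokes
  equations and applications*, Acta Math. 203 (2009) 83–105 = arXiv:0709.3599 (arXiv pages):
  proof of Theorem 6.2, last paragraph, p. 13; (3.3), (3.8), (3.10), pp. 6–7.
  [KochNadirashviliSereginSverak2009]
-/

noncomputable section

open MeasureTheory Set Function Filter TopologicalSpace
open _root_.Topology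
open scoped ENNReal NNReal

namespace Literature.Analysis.FluidPDE

section MildVertex

/-- **KNSS 2009, the vertex estimate of the proof of Theorem 6.2 over mild data, discharged**
(Acta Math. 203 (2009) = arXiv:0709.3599, proof of Theorem 6.2, last paragraph, arXiv p. 13).
The named fact `KNSS2009_typeI_rate_mildVertex` holds: along the data of the blow-up fact, with
the Oseen integral equation for the `w⁽ᵏ⁾` between all times of `(A_k, B_k)` as a hypothesis,
the `w⁽ᵏ⁾` are asymptotically equicontinuous in time at the vertex. Proof (the printed paragraph
made quantitative in `ε/3`'s, as in `KNSS2009_typeI_rate_vertex_of_mild`): for `A_k < -1` and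
`-1 < t ≤ 0 < B_k` the hypothesis gives
`w⁽ᵏ⁾(t, 0) = e^{(t+1)Δ}w⁽ᵏ⁾(-1)(0) - B¹_{-1}(w⁽ᵏ⁾, w⁽ᵏ⁾)(t)(0)`; the datum is bounded by `C`
((wkbound3) at `τ = -1`), so the caloric part moves by at most `K_h √(-τ)` between the times
`1 + τ` and `1` (`norm_heatExtension_sub_heatExtension_le_of_bound`); the Duhamel term splits
along `ℝ³ = 𝒞_k ⊔ 𝒞_kᶜ` (`oseenDuhamel_eq_add_of_indicator_compl`); off the cylinder
`|w⁽ᵏ⁾| ≤ K` (wkbound), so that part has a modulus of continuity in time depending only on `K`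
(`exists_forall_norm_oseenDuhamel_sub_le`, (3.10)); and the cylinder part is `O(K²/M_k)`
uniformly in `t ∈ (-1, 0]` (`exists_norm_oseenDuhamel_cylinder_vertex_le`, i.e. (3.8),
(wkbound2) and `I(M) → 0`). [cite: KochNadirashviliSereginSverak2009, proof of Thm 6.2, last paragraph (arXiv p. 13), with (3.3), (3.8), (3.10) (pp. 6–7)] -/
theorem KNSS2009_typeI_rate_mildVertex_holds : KNSS2009_typeI_rate_mildVertex := by
  intro C K M A B w q hC hK hMpos hMlim hAlim hBpos hw hmild hL hI hoff hmul ε hε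
  obtain ⟨C₂, hC₂, hcyl⟩ := exists_norm_oseenDuhamel_cylinder_vertex_le
  -- the heat modulus constant (dimension three, `τ₁ = 1/2`)
  set Kh : ℝ := (1 + 2 * (2 : ℝ) ^ ((Module.finrank ℝ (EuclideanSpace ℝ (Fin 3)) : ℝ) / 2)) *
    ((2 : ℝ) ^ ((Module.finrank ℝ (EuclideanSpace ℝ (Fin 3)) : ℝ) / 2) * ((1 / 2 : ℝ) / 2) ^ (-(1 / 2 : ℝ)) * C)
    with hKh
  have hKh0 : 0 ≤ Kh := by positivity
  -- `δ₁` for the caloric part, `δ₂` for the off-cylinder Duhamel part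
  set η : ℝ := ε / 3 / (Kh + 1) with hη
  have hη0 : 0 < η := by positivity
  set δ₁ : ℝ := min (1 / 2) (η ^ 2) with hδ₁
  have hδ₁pos : 0 < δ₁ := lt_min (by norm_num) (by positivity)
  have hδ₁half : δ₁ ≤ 1 / 2 := min_le_left _ _
  obtain ⟨δ₂, hδ₂pos, hmod⟩ := exists_forall_norm_oseenDuhamel_sub_le (E := EuclideanSpace ℝ (Fin 3))
    one_pos one_pos hK.le (by positivity : (0 : ℝ) < ε / 3)
  refine ⟨min δ₁ δ₂, lt_min hδ₁pos hδ₂pos, ?_⟩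
  -- eventually `A_k < -1` and `C₂ K² / M_k ≤ ε / 6`
  have hev1 : ∀ᶠ k in atTop, A k < -1 := hAlim.eventually_lt_atBot (-1)
  have hev2 : ∀ᶠ k in atTop, C₂ * K ^ 2 / M k ≤ ε / 6 := by
    filter_upwards [hMlim.eventually_ge_atTop (6 * C₂ * K ^ 2 / ε)] with k hk
    rw [div_le_iff₀ hε] at hk
    rw [div_le_iff₀ (hMpos k)]
    linarith
  filter_upwards [hev1, hev2] with k hk1 hk2 τ hτ
  -- unpack the time
  have hτ0 : τ ≤ 0 := hτ.2
  have hτ1 : -δ₁ ≤ τ := le_trans (neg_le_neg (min_le_left δ₁ δ₂)) hτ.1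
  have hτ2 : -δ₂ ≤ τ := le_trans (neg_le_neg (min_le_right δ₁ δ₂)) hτ.1
  have hτm : -1 < τ := by linarith
  -- the data of the `k`-th field
  have hMk := hMpos k
  have hBk := hBpos k
  set c : EuclideanSpace ℝ (Fin 3) := EuclideanSpace.single 0 (-M k) with hc
  set Cyl : Set (EuclideanSpace ℝ (Fin 3)) := {y | cylRadius (y - c) ≤ M k / 2} with hCyl
  have hCylm : MeasurableSet Cyl := measurableSet_cylinder (M k)
  have hcont : ContinuousOn (uncurry (w k)) (Ioo (A k) (B k) ×ˢ univ) :=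
    (hw k).smooth_velocity.continuousOn
  obtain ⟨L, hLk⟩ := hL k
  have hL0 : 0 ≤ L := (norm_nonneg _).trans (hLk 0 ⟨by linarith, le_rfl⟩ 0)
  -- the representation formula (3.3) at the vertex for `-1 < t ≤ 0`, from the Oseen hypothesis
  have hrep : ∀ t : ℝ, -1 < t → t ≤ 0 →
      w k t 0 = UnboundedOperators.heatExtension (w k (-1)) (t - (-1)) 0 -
        oseenDuhamel 1 (-1) (w k) (w k) t 0 := fun t ht1 ht0 =>
    hmild k (-1) t hk1 ht1 (ht0.trans_lt hBk) 0
  -- the split of the Duhamel term along the cylinder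
  set wc : ℝ → EuclideanSpace ℝ (Fin 3) → EuclideanSpace ℝ (Fin 3) := fun τ y => Cyl.indicator (w k τ) y
    with hwc
  set wo : ℝ → EuclideanSpace ℝ (Fin 3) → EuclideanSpace ℝ (Fin 3) := fun τ y => Cylᶜ.indicator (w k τ) y
    with hwo
  have hsplit : ∀ t : ℝ, -1 < t → t ≤ 0 →
      oseenDuhamel 1 (-1) (w k) (w k) t 0 = oseenDuhamel 1 (-1) wc wc t 0 + oseenDuhamel 1 (-1) wo wo t 0 :=
    fun t ht1 ht0 => oseenDuhamel_eq_add_of_indicator_compl one_pos hcont hk1.le (ht0.trans hBk.le)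
      ht1 hL0 (fun τ' hτ' y => hLk τ' ⟨by linarith [hτ'.1], hτ'.2.le.trans ht0⟩ y) hCylm 0
  -- (1) the caloric part
  have hheat : ‖UnboundedOperators.heatExtension (w k (-1)) (0 - (-1)) 0 -
      UnboundedOperators.heatExtension (w k (-1)) (τ - (-1)) 0‖ ≤ ε / 3 := by
    have hm1 : (-1 : ℝ) ∈ Ioo (A k) (B k) := ⟨hk1, by linarith⟩
    have ham : AEStronglyMeasurable (w k (-1)) volume :=
      ((hw k).contDiff_velocity hm1).continuous.aestronglyMeasurable
    have haC : ∀ y, ‖w k (-1) y‖ ≤ C := by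
      intro y
      have h := hI k (-1) ⟨hk1, by norm_num⟩ y
      simpa using h
    have h := norm_heatExtension_sub_heatExtension_le_of_bound ham haC (τ₁ := 1 / 2) (τ := 1 + τ)
      (τ' := 1) (by norm_num) (by linarith) (by linarith) 0
    rw [show (1 : ℝ) - (1 + τ) = -τ by ring, ← Real.sqrt_eq_rpow] at h
    rw [show (0 : ℝ) - (-1) = 1 by ring, show τ - (-1) = 1 + τ by ring]
    refine h.trans ?_
    change Kh * Real.sqrt (-τ) ≤ ε / 3
    have hs : Real.sqrt (-τ) ≤ η := by
      calc Real.sqrt (-τ) ≤ Real.sqrt δ₁ := Real.sqrt_le_sqrt (by linarith)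
        _ ≤ Real.sqrt (η ^ 2) := Real.sqrt_le_sqrt (min_le_right _ _)
        _ = η := Real.sqrt_sq hη0.le
    calc Kh * Real.sqrt (-τ) ≤ Kh * η := by gcongr
      _ = ε / 3 * (Kh / (Kh + 1)) := by rw [hη]; field_simp
      _ ≤ ε / 3 * 1 := by
          gcongr
          rw [div_le_one (by positivity)]; linarith
      _ = ε / 3 := mul_one _
  -- (2) the off-cylinder part
  have hoffp : ‖oseenDuhamel 1 (-1) wo wo 0 0 - oseenDuhamel 1 (-1) wo wo τ 0‖ ≤ ε / 3 := by
    have hwom : AEStronglyMeasurable (uncurry wo)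
        ((volume : Measure (ℝ × EuclideanSpace ℝ (Fin 3))).restrict (Ioo (-1) 0 ×ˢ univ)) :=
      aestronglyMeasurable_uncurry_indicator_space hcont hk1.le hBk.le hCylm.compl
    have hwoK : ∀ τ' ∈ Ioo (-1 : ℝ) 0, ∀ y, ‖wo τ' y‖ ≤ K := by
      intro τ' hτ' y
      simp only [hwo]
      by_cases hy : y ∈ Cylᶜ
      · rw [indicator_of_mem hy]
        exact hoff k τ' ⟨by linarith [hτ'.1], hτ'.2.le⟩ y (lt_of_not_ge hy)
      · rw [indicator_of_notMem hy, norm_zero]; exact hK.le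
    exact hmod (by norm_num) hwom hwom hwoK hwoK (by linarith) hτ0 le_rfl (by linarith) 0
  -- (3) the cylinder part
  have hcylp : ∀ t : ℝ, -1 < t → t ≤ 0 → ‖oseenDuhamel 1 (-1) wc wc t 0‖ ≤ ε / 6 := by
    intro t ht1 ht0
    have h := hcyl hK hMk (fun τ' hτ' y => hmul k τ' ⟨by linarith [hτ'.1], hτ'.2.le⟩ y) ht1 ht0
    exact h.trans hk2
  -- assemble
  set H0 := UnboundedOperators.heatExtension (w k (-1)) (0 - (-1)) 0 with hH0
  set Hτ := UnboundedOperators.heatExtension (w k (-1)) (τ - (-1)) 0 with hHτ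
  set P0 := oseenDuhamel 1 (-1) wo wo 0 0 with hP0
  set Pτ := oseenDuhamel 1 (-1) wo wo τ 0 with hPτ
  set Q0 := oseenDuhamel 1 (-1) wc wc 0 0 with hQ0
  set Qτ := oseenDuhamel 1 (-1) wc wc τ 0 with hQτ
  have hdec : w k 0 0 - w k τ 0 = (H0 - Hτ) - (P0 - Pτ) - Q0 + Qτ := by
    rw [hrep 0 (by norm_num) le_rfl, hrep τ hτm hτ0, hsplit 0 (by norm_num) le_rfl,
      hsplit τ hτm hτ0]
    abel
  rw [hdec]
  calc ‖(H0 - Hτ) - (P0 - Pτ) - Q0 + Qτ‖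
      ≤ ‖(H0 - Hτ) - (P0 - Pτ) - Q0‖ + ‖Qτ‖ := norm_add_le _ _
    _ ≤ ‖(H0 - Hτ) - (P0 - Pτ)‖ + ‖Q0‖ + ‖Qτ‖ := by gcongr; exact norm_sub_le _ _
    _ ≤ ‖H0 - Hτ‖ + ‖P0 - Pτ‖ + ‖Q0‖ + ‖Qτ‖ := by gcongr; exact norm_sub_le _ _
    _ ≤ ε / 3 + ε / 3 + ε / 6 + ε / 6 := by
        linarith [hheat, hoffp, hcylp 0 (by norm_num) le_rfl, hcylp τ hτm hτ0]
    _ = ε := by ring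

end MildVertex

end Literature.Analysis.FluidPDE

end
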